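import Summits.NavierStokesRegularity.NavierStokesRegularity.Theorems.TypeICertificateLadderTargetStretchingChannelsRung
import Literature.Analysis.FluidPDE.ConstantinDirectionDissipationCalculus
import HarnessLib

/-!
# Crux `Target` = `TypeICertificateLadder.NoTypeIBlowup` (stmt-NavierStokesRegularity-1217), line
# `depletion-ladder`: THE VORTICITY-SIDE CHANNELS OF ENSTROPHY PRODUCTION, V — the Frenet reading of the
# longitudinal channel: `‖∂_ξω‖² = (∂_ξ|ω|)² + |ω|²κ²` (slope of `|ω|` along the vortex line, and its CURVATURE)

`--supports stmt-NavierStokesRegularity-1217` (helper; file 5 of the channel series; consumer of `…ChannelsRung` and of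
the tree's direction calculus `vorticityDirection`, `fderiv_vorticityDirection_apply`,
`norm_mul_norm_sq_fderiv_vorticityDirection_apply` (Constantin 1990 typing)). Author: STA lineage `ns-sta-19551-p1` (g12).

With `ξ = vorticityDirection ω = ω/|ω|` (junk `0` where `ω = 0`) and at a point of differentiability of `ω`:

* `fderiv_norm_apply_of_ne` — `D|ω|(x) e = ⟪ω, Dω e⟫/|ω|` (`ω(x) ≠ 0`);
* `inner_vorticityDirection_fderiv_apply` — `⟪ξ, Dξ e⟫ = 0`: `∂_ξξ ⊥ ξ`, so `Dξ(x) ξ(x) = κ n` is the curvature vector of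
  the vortex line through `x` and `‖Dξ ξ‖ = κ`;
* `longitudinalSq_eq_slope_sq_add_curvature_sq` — **`‖Dω ω‖²/‖ω‖² = (D|ω| ξ)² + |ω|² ‖Dξ ξ‖²`** at EVERY point of
  differentiability (both sides vanish where `ω = 0`): the longitudinal palinstrophy density of file I splits into the
  squared slope of `|ω|` ALONG the line and `|ω|²κ²`;
* `integral_longitudinalSq_eq_frenet` — the integrated form for `ω = curl v`, `v ∈ C²`;
* `frequently_slope_add_curvature_gt` — the Type-I PORTRAIT of file III in Constantin's geometric language: at a
  Type-I(`C`) singular time of a classical Leray–Hopf rapidly-decaying-datum solution, for every `η` with `ηC < 1`,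
  FREQUENTLY as `t ↑ T`: `∫ ((∂_ξ|ω|)² + |ω|²κ²) > η² ‖∇ω‖₂²` — vortex lines that straighten (`κ → 0` in `|ω|²`-weighted
  `L²`) while `|ω|` equalises along them, fast enough in palinstrophy fraction, are incompatible with Type-I blow-up.

Compare the a-priori side (BC9 of the route): Constantin's budget `ν∫∫|ω||∇ξ|² ≤ C(u₀)` weighs ALL of `∇ξ` with weight
`|ω|¹`; the enstrophy channel needs only the column `∂_ξξ` but with weight `|ω|²` — the gap between weight 1 and weight 2
is the declared ceiling. WHAT THIS IS NOT: kinematics and a conditional portrait; nothing on Type II. [folklore]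

References: P. Constantin, Comm. Math. Phys. 129 (1990), (2.9)–(2.11), Thm 2.1; Constantin–Fefferman, Indiana Univ.
Math. J. 42 (1993) §1; Majda–Bertozzi (2002) §1.2.
-/

noncomputable section

open Set Filter Topology MeasureTheory
open scoped RealInnerProductSpace ENNReal NNReal ContDiff
open Literature.Analysis.FluidPDE

namespace Summit.NavierStokesRegularity.NavierStokesRegularity.Theorems.DepletionLadder

-- the problem directory repeats the summit name (`NavierStokesRegularity/NavierStokesRegularity`)
set_option linter.dupNamespace false

open Summit.NavierStokesRegularity.NavierStokesRegularity.Theorems.RungReynoldsOne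

namespace Channels

variable {w : EuclideanSpace ℝ (Fin 3) → EuclideanSpace ℝ (Fin 3)} {x : EuclideanSpace ℝ (Fin 3)}

/-! ## Pointwise Frenet calculus of the direction field -/

/-- **Derivative of the modulus**: `D|w|(x) e = ⟪w(x), Dω(x) e⟫/|w(x)|` at a point of differentiability with
`w(x) ≠ 0` (the tree's regularised modulus `√(|w|² + ε²)` at `ε = 0`). [folklore] -/
theorem fderiv_norm_apply_of_ne (h : DifferentiableAt ℝ w x) (hx : w x ≠ 0) (e : EuclideanSpace ℝ (Fin 3)) :
    fderiv ℝ (fun y => ‖w y‖) x e = ⟪w x, fderiv ℝ w x e⟫ / ‖w x‖ := by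
  have hne : ‖w x‖ ^ 2 + (0 : ℝ) ^ 2 ≠ 0 := by
    have : 0 < ‖w x‖ := norm_pos_iff.2 hx
    positivity
  have hfun : (fun y => ‖w y‖) = fun y => Real.sqrt (‖w y‖ ^ 2 + (0 : ℝ) ^ 2) := by
    funext y; rw [regN_zero]
  rw [hfun, fderiv_regN_comp_apply h hne e, regN_zero]

/-- **`∂ξ ⊥ ξ`**: `⟪ξ(x), Dξ(x) e⟫ = 0` for `ξ = vorticityDirection w` at a point of differentiability with `w(x) ≠ 0`
(unit field). In particular `Dξ(x) ξ(x)` is the curvature vector `κ n` of the vortex line. [folklore] -/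
theorem inner_vorticityDirection_fderiv_apply (h : DifferentiableAt ℝ w x) (hx : w x ≠ 0)
    (e : EuclideanSpace ℝ (Fin 3)) :
    ⟪vorticityDirection w x, fderiv ℝ (vorticityDirection w) x e⟫ = 0 := by
  have hr : ‖w x‖ ≠ 0 := norm_ne_zero_iff.2 hx
  rw [fderiv_vorticityDirection_apply h hx e]
  change ⟪‖w x‖⁻¹ • w x, _⟫ = 0
  rw [inner_sub_right, real_inner_smul_left, real_inner_smul_right, real_inner_smul_left, real_inner_smul_right,
    real_inner_self_eq_norm_sq]
  field_simp
  ring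

/-- **The Frenet split of the longitudinal density.** At every point of differentiability of `w`:
`‖Dω(x) w(x)‖²/‖w(x)‖² = (D|w|(x) ξ(x))² + ‖w(x)‖² · ‖Dξ(x) ξ(x)‖²`, `ξ = vorticityDirection w` — squared slope of
`|w|` along the vortex line plus `|w|²κ²`; both sides vanish where `w(x) = 0` (`ξ(x) = 0` there). [folklore] -/
theorem longitudinalSq_eq_slope_sq_add_curvature_sq (h : DifferentiableAt ℝ w x) :
    ‖fderiv ℝ w x (w x)‖ ^ 2 / ‖w x‖ ^ 2 =
      (fderiv ℝ (fun y => ‖w y‖) x (vorticityDirection w x)) ^ 2 +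
        ‖w x‖ ^ 2 * ‖fderiv ℝ (vorticityDirection w) x (vorticityDirection w x)‖ ^ 2 := by
  by_cases hx : w x = 0
  · have hξ : vorticityDirection w x = 0 := by
      change ‖w x‖⁻¹ • w x = 0
      rw [hx, smul_zero]
    rw [hξ, hx]; simp
  · have hr : ‖w x‖ ≠ 0 := norm_ne_zero_iff.2 hx
    have hpos : 0 < ‖w x‖ := norm_pos_iff.2 hx
    set e : EuclideanSpace ℝ (Fin 3) := vorticityDirection w x with hedef
    have he : e = ‖w x‖⁻¹ • w x := rfl
    -- `Dω e = |w|⁻¹ Dω w`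
    have hDe : fderiv ℝ w x e = ‖w x‖⁻¹ • fderiv ℝ w x (w x) := by rw [he, map_smul]
    -- the tree's identity `|w| ‖Dξ e‖² = (‖Dω e‖²|w|² − ⟪w, Dω e⟫²)/|w|³`
    have hcurv := norm_mul_norm_sq_fderiv_vorticityDirection_apply h hx e
    have hslope : fderiv ℝ (fun y => ‖w y‖) x e = ⟪w x, fderiv ℝ w x e⟫ / ‖w x‖ :=
      fderiv_norm_apply_of_ne h hx e
    -- express everything through `a = ‖Dω w‖`, `b = ⟪w, Dω w⟫`
    have hne : ‖fderiv ℝ w x e‖ ^ 2 = ‖fderiv ℝ w x (w x)‖ ^ 2 / ‖w x‖ ^ 2 := by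
      rw [hDe, norm_smul, norm_inv, norm_norm, mul_pow, inv_pow]; ring
    have hie : ⟪w x, fderiv ℝ w x e⟫ = ⟪w x, fderiv ℝ w x (w x)⟫ / ‖w x‖ := by
      rw [hDe, real_inner_smul_right]; ring
    have hK : ‖fderiv ℝ (vorticityDirection w) x e‖ ^ 2 =
        (‖fderiv ℝ w x e‖ ^ 2 * ‖w x‖ ^ 2 - ⟪w x, fderiv ℝ w x e⟫ ^ 2) / ‖w x‖ ^ 4 := by
      rw [show (‖fderiv ℝ w x e‖ ^ 2 * ‖w x‖ ^ 2 - ⟪w x, fderiv ℝ w x e⟫ ^ 2) / ‖w x‖ ^ 4 =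
          (‖fderiv ℝ w x e‖ ^ 2 * ‖w x‖ ^ 2 - ⟪w x, fderiv ℝ w x e⟫ ^ 2) / ‖w x‖ ^ 3 / ‖w x‖ by
            rw [div_div]; ring,
        ← hcurv, mul_div_cancel_left₀ _ hr]
    rw [hslope, hK, hne, hie]
    field_simp
    ring

/-! ## Integrated form and the Type-I portrait in Frenet language -/

variable {v : EuclideanSpace ℝ (Fin 3) → EuclideanSpace ℝ (Fin 3)}

/-- **Integrated Frenet split** for `w = curl v`, `v ∈ C²`: `∫‖Dω w‖²/‖w‖² = ∫ ((D|w| ξ)² + |w|²‖Dξ ξ‖²)` — the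
longitudinal palinstrophy `‖∂_ξω‖₂²` of file I is the squared `L²` slope of `|w|` along the vortex lines plus the
`|w|²`-weighted squared curvature. [folklore] -/
theorem integral_longitudinalSq_eq_frenet (hv : ContDiff ℝ 2 v) :
    ∫ y, ‖fderiv ℝ (curl v) y (curl v y)‖ ^ 2 / ‖curl v y‖ ^ 2 =
      ∫ y, ((fderiv ℝ (fun z => ‖curl v z‖) y (vorticityDirection (curl v) y)) ^ 2 +
        ‖curl v y‖ ^ 2 *
          ‖fderiv ℝ (vorticityDirection (curl v)) y (vorticityDirection (curl v) y)‖ ^ 2) := by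
  have hw1 : ContDiff ℝ 1 (curl v) := contDiff_one_curl_of_contDiff_two hv
  refine integral_congr_ae (Eventually.of_forall fun y => ?_)
  exact longitudinalSq_eq_slope_sq_add_curvature_sq ((hw1.differentiable one_ne_zero) y)

/-- **PORTRAIT (Frenet form): a Type-I blow-up keeps slope-plus-curvature palinstrophy.** If the classical
Leray–Hopf rapidly-decaying-datum solution on `[0,T)` has eventual rate `√(T−t)|u| ≤ C√ν` and does NOT extend past
`T`, then for every `0 ≤ η` with `ηC < 1`, FREQUENTLY as `t ↑ T`:
`∫ ((∂_ξ|w|)² + |w|²κ²) > η² ‖∇w(t)‖₂²` (`κ = ‖Dξ ξ‖` the curvature of the vortex lines, `∂_ξ|w| = D|w| ξ`).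
[folklore] -/
theorem frequently_slope_add_curvature_gt {ν T C η : ℝ} (hν : 0 < ν) (hT : 0 < T) (hC : 0 < C) (hη0 : 0 ≤ η)
    (hηC : η * C < 1)
    {u : ℝ → EuclideanSpace ℝ (Fin 3) → EuclideanSpace ℝ (Fin 3)}
    {p : ℝ → EuclideanSpace ℝ (Fin 3) → ℝ}
    (hsol : IsClassicalNSSolutionOn (Ico 0 T) ν 0 u p) (hLH : IsLerayHopfOn T ν 0 (u 0) u)
    (hdec : HasRapidSpatialDecay (u 0))
    (hrate : ∀ᶠ t in 𝓝[<] T, ∀ x, Real.sqrt (T - t) * ‖u t x‖ ≤ C * Real.sqrt ν)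
    (hsing : ¬ HasSmoothExtensionPast ν 0 u T) :
    ∃ᶠ t in 𝓝[<] T,
      η ^ 2 * ∫ y, frobeniusNormSq (fderiv ℝ (curl (u t)) y) <
        ∫ y, ((fderiv ℝ (fun z => ‖curl (u t) z‖) y (vorticityDirection (curl (u t)) y)) ^ 2 +
          ‖curl (u t) y‖ ^ 2 *
            ‖fderiv ℝ (vorticityDirection (curl (u t))) y (vorticityDirection (curl (u t)) y)‖ ^ 2) := by
  have h := frequently_longitudinalFraction_gt hν hT hC hη0 hηC hsol hLH hdec hrate hsing
  have hlt : ∀ᶠ t in 𝓝[<] T, t < T := eventually_nhdsWithin_of_forall fun t ht => ht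
  have h0 : ∀ᶠ t in 𝓝[<] T, 0 ≤ t := by
    have : Ioo 0 T ∈ 𝓝[<] T := Ioo_mem_nhdsLT hT
    filter_upwards [this] with t ht using ht.1.le
  refine (h.and_eventually (hlt.and h0)).mono fun t ⟨ht, htT, ht0⟩ => ?_
  have hv : ContDiff ℝ ∞ (u t) := hsol.contDiff_velocity ⟨ht0, htT⟩
  rwa [integral_longitudinalSq_eq_frenet (hv.of_le (by norm_cast))] at ht

end Channels

end Summit.NavierStokesRegularity.NavierStokesRegularity.Theorems.DepletionLadder

end
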